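import Summits.BirchSwinnertonDyer.BirchSwinnertonDyer.Theorems.EdixhovenFibreFiveSevenStarredOptimalManinUnitFiveSevenAssemblySocket
import HarnessLib

/-!
# F″ programme, ASSEMBLY ADAPTERS between the P1 draft (`KatoSL2NeronValues.exists_member_sl2ZetaElement_neron_values`,
# seat manin-p1 g8, `Cruxes/ManinFrameResidueProper/Lines/P1_DRAFT_KatoSL2NeronValues_manin_p1_g8.lean`) and the assembly
# socket H′ (`KatoAssemblySocket.kato_neron_five_le_of_memberCharSumLaw`, p600780)
# (route `EdixhovenFibreFiveSeven`, crux K★ `StarredOptimalManinUnitFiveSeven`, stmt-BirchSwinnertonDyer-22226, line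
# `kato-lever`; `--supports` 22226, helper)

Cell `pub/bsd-wall`, seat `bsd-line-edix-p4` g3. TOOL lemmas only (no definition, no named fact, no `sorry`); nothing is
closed or booked; BSD is not proved by any of this.

WHY. The P1 draft (Kato (8.1.3) + Thm. 9.7 + Thm. 6.6 (1), case `ξ ∈ SL₂(ℤ)`, + Thm. 13.6, at Kato's member, Néron-pinned)
states its value law for EVERY character `χ′` mod `m` in the form
`charSum m ι χ′ x = (c² − c·χ′(c))·(d² − d·χ′(d)⁻¹)·(n ξ b)·(Lχ′ 1 / Ω^±(W′))` under the parity hypotheses `χ′(−1) = 1` /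
`χ′(−1) = −1`, with `c d : ℤ`, `c ≡ 1 [ZMOD N]`, `d ≡ 1 [ZMOD N]`, `Int.gcd (c*d) (6*p*m) = 1`, and a Manin-symbol
coordinate `n ξ b ∈ ℚ` with `n ξ b ≠ 0 ∧ padicValRat p (n ξ b) = 0`. The socket H′ consumes it at `χ′ := χ⁻¹` (F″'s
`L` is the depleted series of `χ̄`), with `c d : ℕ` carrying the unit-choice conclusions of
`KatoUnitChoice.exists_unitChoice_kato`, roots `μ ∈ {χ(c), χ⁻¹(c)}`, `ν ∈ {χ(d), χ⁻¹(d)}`, a rational `q` with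
`p ∤ num q`, and Mathlib's `χ.Even` / `χ.Odd`. This file proves the five one-step conversions, so that the final
assembly `F″ ⟸ P1 + (S5b) + [level = conductor]` is pure instantiation.

WHAT IS PROVED.
* §1 `inv_apply_neg_one_eq_one_iff` / `inv_apply_neg_one_eq_neg_one_iff` — `χ⁻¹(−1) = 1 ↔ χ.Even`,
  `χ⁻¹(−1) = −1 ↔ χ.Odd`; `inv_inv_apply` — `(χ⁻¹(a))⁻¹ = χ(a)`.
* §2 `not_dvd_num_of_padicValRat_eq_zero` — `q ≠ 0`, `padicValRat p q = 0` ⟹ `p ∤ num q`.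
* §3 `intModEq_one_of_natModEq_one` — `c ≡ 1 [MOD N]` ⟹ `(c : ℤ) ≡ 1 [ZMOD N]`;
  `int_gcd_mul_eq_one_of_coprime` — `gcd(c, 6·m·p·N) = gcd(d, 6·m·p·N) = 1` ⟹ `Int.gcd (c·d) (6·p·m) = 1`
  (the P1 draft's guard from the unit-choice guard).
* §4 `katoFactor_inv_reading` — the draft's factor at `χ⁻¹` is the socket's with `μ = χ⁻¹(c)`, `ν = χ(d)`:
  `(c² − c·χ⁻¹(c))·(d² − d·(χ⁻¹(d))⁻¹) = (c² − c·χ⁻¹(c))·(d² − d·χ(d))`.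

References: programme `Cruxes/StarredOptimalManinUnitFiveSeven/Lines/kato-lever-F2-programme.md` §4/§8,
`…/Lines/kato-lever-assembly-socket.md`; [Kato2004Asterisque] Thm. 6.6 (1) p. 163 (the factor `T`), Thm. 13.6 p. 227.
All lemmas are [folklore].
-/

set_option autoImplicit false
-- the Theorems namespace of a single-conjunct summit repeats the summit name by design (D-0017)
set_option linter.dupNamespace false

noncomputable section

namespace Summit.BirchSwinnertonDyer.BirchSwinnertonDyer.Theorems.KatoAssemblySocket

/-! ## §1 Parity and inversion of Dirichlet characters -/

/-- `χ⁻¹(−1) = 1 ↔ χ` is even (`χ⁻¹(a) = χ(a)⁻¹`). [folklore] -/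
theorem inv_apply_neg_one_eq_one_iff {m : ℕ} (χ : DirichletCharacter ℂ m) : χ⁻¹ (-1) = 1 ↔ χ.Even := by
  rw [DirichletCharacter.Even, MulChar.inv_apply_eq_inv', inv_eq_one]

/-- `χ⁻¹(−1) = −1 ↔ χ` is odd. [folklore] -/
theorem inv_apply_neg_one_eq_neg_one_iff {m : ℕ} (χ : DirichletCharacter ℂ m) :
    χ⁻¹ (-1) = -1 ↔ χ.Odd := by
  rw [DirichletCharacter.Odd, MulChar.inv_apply_eq_inv', inv_eq_iff_eq_inv, inv_neg_one]

/-- `(χ⁻¹(a))⁻¹ = χ(a)`. [folklore] -/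
theorem inv_inv_apply {m : ℕ} (χ : DirichletCharacter ℂ m) (a : ZMod m) : (χ⁻¹ a)⁻¹ = χ a := by
  rw [MulChar.inv_apply_eq_inv', inv_inv]

/-! ## §2 The Manin-symbol coordinate: `padicValRat p q = 0`, `q ≠ 0` ⟹ `p ∤ num q` -/

/-- A non-zero rational of `p`-adic valuation `0` has numerator prime to `p` (numerator and denominator are
coprime, so `p ∣ num q` would force `padicValRat p q = padicValInt p (num q) ≥ 1`). [folklore] -/
theorem not_dvd_num_of_padicValRat_eq_zero {p : ℕ} [hp : Fact p.Prime] {q : ℚ} (hq : q ≠ 0)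
    (h : padicValRat p q = 0) : ¬ (p : ℤ) ∣ q.num := by
  intro hdvd
  have hnum0 : q.num ≠ 0 := Rat.num_ne_zero.2 hq
  have hpnum : p ∣ q.num.natAbs := Int.ofNat_dvd_left.1 hdvd
  have hnotden : ¬ p ∣ q.den := by
    intro hden
    have h1 : p ∣ Nat.gcd q.num.natAbs q.den := Nat.dvd_gcd hpnum hden
    rw [q.reduced, Nat.dvd_one] at h1
    exact hp.out.ne_one h1
  have hval : 1 ≤ padicValInt p q.num :=
    one_le_padicValNat_of_dvd (Int.natAbs_ne_zero.2 hnum0) hpnum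
  rw [padicValRat_def, padicValNat.eq_zero_of_not_dvd hnotden, Nat.cast_zero, sub_zero] at h
  omega

/-! ## §3 The unit-choice guards (`c d : ℕ`) in the draft's `ℤ`-currency -/

/-- `c ≡ 1 (mod N)` in `ℕ` gives `(c : ℤ) ≡ 1 [ZMOD N]`. [folklore] -/
theorem intModEq_one_of_natModEq_one {c N : ℕ} (h : c ≡ 1 [MOD N]) : (c : ℤ) ≡ 1 [ZMOD (N : ℤ)] := by
  have h' := Int.natCast_modEq_iff.2 h
  simpa using h'

/-- From `gcd(c, 6·(m·(p·N))) = 1` and `gcd(d, 6·(m·(p·N))) = 1` (the unit-choice guards): the draft's guard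
`Int.gcd (c·d) (6·p·m) = 1`. [folklore] -/
theorem int_gcd_mul_eq_one_of_coprime {p N m c d : ℕ} (hc : c.Coprime (6 * (m * (p * N))))
    (hd : d.Coprime (6 * (m * (p * N)))) : Int.gcd ((c : ℤ) * (d : ℤ)) (6 * (p : ℤ) * (m : ℤ)) = 1 := by
  have hdvd : 6 * p * m ∣ 6 * (m * (p * N)) := ⟨N, by ring⟩
  have hc' : c.Coprime (6 * p * m) := Nat.Coprime.coprime_dvd_right hdvd hc
  have hd' : d.Coprime (6 * p * m) := Nat.Coprime.coprime_dvd_right hdvd hd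
  have hcd : (c * d).Coprime (6 * p * m) := Nat.Coprime.mul_left hc' hd'
  have hcast : ((c : ℤ) * (d : ℤ)) = ((c * d : ℕ) : ℤ) := by push_cast; ring
  have hcast' : (6 * (p : ℤ) * (m : ℤ)) = ((6 * p * m : ℕ) : ℤ) := by push_cast; ring
  rw [hcast, hcast', Int.gcd_natCast_natCast]
  exact hcd

/-! ## §4 The draft's factor at `χ⁻¹` in the socket's alternatives -/

/-- Kato's factor of the draft's value law read at `χ′ = χ⁻¹`:
`(c² − c·χ⁻¹(c))·(d² − d·(χ⁻¹(d))⁻¹) = (c² − c·χ⁻¹(c))·(d² − d·χ(d))` — i.e. the socket's `μ = χ⁻¹(c)` (second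
alternative) and `ν = χ(d)` (first alternative). [cite: Kato2004Asterisque, Thm. 6.6 (1) p. 163] -/
theorem katoFactor_inv_reading {m : ℕ} (χ : DirichletCharacter ℂ m) (c d : ℂ) (a b : ZMod m) :
    (c ^ 2 - c * χ⁻¹ a) * (d ^ 2 - d * (χ⁻¹ b)⁻¹) = (c ^ 2 - c * χ⁻¹ a) * (d ^ 2 - d * χ b) := by
  rw [inv_inv_apply]

end Summit.BirchSwinnertonDyer.BirchSwinnertonDyer.Theorems.KatoAssemblySocket

end
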